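import Literature.AlgebraicGeometry.Frobenioids.UnitWiseFrobeniusZeta
import Mathlib.CategoryTheory.Comma.Arrow
import Mathlib.CategoryTheory.Conj
import HarnessLib

/-!
# Frobenioids I, Proposition 2.9 (ii): properties (b), (c), (d) and the statement

Mochizuki, *The geometry of Frobenioids I: the general theory*, Kyushu J. Math. **62** (2008)
293–400, §2, Proposition 2.9 (ii) and its proof, kurims text pp.53–55
[cite: MochizukiFrdI2008, Prop. 2.9(ii) p.53].

For the functor `Ψ` of `UnitWiseFrobeniusZeta.lean`: (b) objects `Ψ(A) = A_P ≅ A`; morphisms of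
Frobenius type / pre-steps / pull-back morphisms go to abstractly equivalent arrows (on `P`-objects
`Ψ_P(F(n);β;α) = F(n);Ψ(β);α` differs from `F(n);β;α` by a unit on the left when `n = 1`, and by a
unit conjugated by the isomorphism `α` on the right when `β` is a unit); (c) `Ψ` on `O^×(A)`,
conjugated by `A_P ≅ A`, is the `ζ`-th power map (naturality of `ζ`-th powers under
`O^×(A_P) ≅ O^×(A)`); (d) `ζ` of co-prime type ⇒ `Ψ_P` bijective on arrows ⇒ `Ψ` an equivalence;
unit-trivial type ⇒ `Ψ_P = id` ⇒ `Ψ ≅ 𝟭`.  Whence `unitWiseFrobeniusZetaExists`.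
-/

noncomputable section

namespace Literature.AlgebraicGeometry.Frobenioids

open CategoryTheory Opposite

universe w v v' u u'

namespace PreFrobenioid

/-- Conjugation of units by an isomorphism `i : A ≅ A'`: `O^×(A) → O^×(A')`, `u ↦ i⁻¹ ; u ; i`.
[cite: MochizukiFrdI2008, Def. 1.2(ii) p.22] -/
def conjUnits {D : Type u} [Category.{v} D] {Φ : Dᵒᵖ ⥤ CommMonCat.{w}} {C : Type u'} [Category.{v'} C]
    {F : C ⥤ ElemFrobenioid Φ} {A A' : C} (i : A ≅ A') : unitsSubgroup F A →* unitsSubgroup F A' where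
  toFun u := ⟨i.conjAut u.1, by
    have h : (i.conjAut u.1).hom = i.inv ≫ u.1.hom ≫ i.hom := by rw [Iso.conjAut_hom, Iso.conj_apply]
    refine ⟨?_, ?_⟩
    · show Base F (i.conjAut u.1).hom = 𝟙 _
      rw [h, base_comp, base_comp, show Base F u.1.hom = 𝟙 _ from u.2.1, Category.id_comp, ← base_comp,
        i.inv_hom_id, base_id]
    · show degFr F (i.conjAut u.1).hom = 1
      rw [h, degFr_comp, degFr_comp, show degFr F u.1.hom = 1 from u.2.2, isLinear_of_isIso F i.inv,
        isLinear_of_isIso F i.hom, one_mul, one_mul]⟩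
  map_one' := Subtype.ext (map_one i.conjAut)
  map_mul' u v := Subtype.ext (map_mul i.conjAut u.1 v.1)

/-- The arrow underlying a conjugated unit. [cite: MochizukiFrdI2008, Def. 1.2(ii) p.22] -/
theorem conjUnits_hom {D : Type u} [Category.{v} D] {Φ : Dᵒᵖ ⥤ CommMonCat.{w}} {C : Type u'} [Category.{v'} C]
    {F : C ⥤ ElemFrobenioid Φ} {A A' : C} (i : A ≅ A') (u : unitsSubgroup F A) :
    (conjUnits (F := F) i u).1.hom = i.inv ≫ u.1.hom ≫ i.hom := by
  show (i.conjAut u.1).hom = _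
  rw [Iso.conjAut_hom, Iso.conj_apply]

/-- Conjugating back. [cite: MochizukiFrdI2008, Def. 1.2(ii) p.22] -/
theorem conjUnits_symm_conjUnits {D : Type u} [Category.{v} D] {Φ : Dᵒᵖ ⥤ CommMonCat.{w}} {C : Type u'}
    [Category.{v'} C] {F : C ⥤ ElemFrobenioid Φ} {A A' : C} (i : A ≅ A') (u : unitsSubgroup F A) :
    conjUnits (F := F) i.symm (conjUnits i u) = u := by
  apply Subtype.ext; apply Iso.ext
  rw [conjUnits_hom, conjUnits_hom, Iso.symm_inv, Iso.symm_hom, Category.assoc, Category.assoc,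
    i.hom_inv_id, Category.comp_id, i.hom_inv_id_assoc]

namespace UnitWiseFrobeniusZeta

variable {D : Type u} [Category.{v} D] {Φ : Dᵒᵖ ⥤ CommMonCat.{w}}
  {C : Type u'} [Category.{v'} C] {F : C ⥤ ElemFrobenioid Φ}
  (hF : IsFrobenioid F) (τ : CharacteristicSplitting F) (hnorm : IsOfType (IsFrobeniusNormalized F))
  (hbt : IsOfType (IsBaseTrivial F)) (histr : IsOfIsotropicType F) (hup : IsOfUnitProfiniteType F)
  {P : Presection C} {Fr : ℕ+ →* End P.ι} (hpair : IsBaseFrobeniusPair F P Fr) (ζ : Nat.Primes → ℕ+)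

open BaseFrobeniusPair

/-! ### Invariants of a factored arrow -/

include hF hpair in
/-- `Div(F(n)_A ; β ; α) = Div(β)` (`F(n)_A` and `α` are isometries, all bases trivial or of degree 1).
[cite: MochizukiFrdI2008, Prop. 2.9(ii) p.55] -/
theorem div_factor {A B : C} (hA : P.obj A) (n : ℕ+) (β : endSubmonoid F A) {α : A ⟶ B} (hα : P.hom α) :
    Div F (frob Fr n hA ≫ (β.1 : A ⟶ A) ≫ α) = divHom F A β := by
  have hFr := hpair.isFrobeniusSection
  obtain ⟨⟨-, hαi⟩, hαl⟩ := hF.iv_b α (hpair.isBaseSection.hom_pullback α hα)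
  rw [div_comp, div_comp, base_frob hFr n hA, pull_id, show Div F (frob Fr n hA) = 1 from
    (isFrobeniusType_frob hFr n hA).1.2, one_pow, mul_one, show Base F (β.1 : A ⟶ A) = 𝟙 _ from β.2.1,
    pull_id, show Div F α = 1 from hαi, one_mul, show degFr F α = 1 from hαl, PNat.one_coe, pow_one]
  rfl

include hpair in
/-- `deg_Fr(F(n)_A ; β ; α) = n`. [cite: MochizukiFrdI2008, Prop. 2.9(ii) p.55] -/
theorem degFr_factor (hF : IsFrobenioid F) {A B : C} (hA : P.obj A) (n : ℕ+) (β : endSubmonoid F A)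
    {α : A ⟶ B} (hα : P.hom α) : degFr F (frob Fr n hA ≫ (β.1 : A ⟶ A) ≫ α) = n := by
  rw [degFr_comp, degFr_comp, degFr_frob hpair.isFrobeniusSection n hA, show degFr F (β.1 : A ⟶ A) = 1
    from β.2.2, (hF.iv_b α (hpair.isBaseSection.hom_pullback α hα)).2, mul_one, mul_one]

include hpair in
/-- `Base(F(n)_A ; β ; α) = Base(α)`. [cite: MochizukiFrdI2008, Prop. 2.9(ii) p.55] -/
theorem base_factor {A B : C} (hA : P.obj A) (n : ℕ+) (β : endSubmonoid F A) (α : A ⟶ B) :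
    Base F (frob Fr n hA ≫ (β.1 : A ⟶ A) ≫ α) = Base F α := by
  rw [base_comp, base_comp, base_frob hpair.isFrobeniusSection n hA, show Base F (β.1 : A ⟶ A) = 𝟙 _
    from β.2.1, Category.id_comp, Category.id_comp]

/-! ### (b): arrows -/

/-- `Ψ_P(ψ)` is abstractly equivalent to `ψ` for linear `ψ` between `P`-objects: `ψ = β ; α`,
`Ψ_P(ψ) = Ψ(β) ; α = (β₀⁻¹ β₀^ζ) ; ψ`. [cite: MochizukiFrdI2008, Prop. 2.9(ii) p.55] -/
theorem arrowIso_of_isLinear {A B : C} (hA : P.obj A) (hB : P.obj B) (ψ : A ⟶ B) (hlin : IsLinear F ψ) :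
    IsAbstractlyEquivalent (psiHom hF τ histr hup hpair ζ hA hB ψ) ψ := by
  have hFr := hpair.isFrobeniusSection
  set t := factorOf hF hpair hA hB ψ
  have h : frob Fr t.1 hA ≫ (t.2.1.1 : A ⟶ A) ≫ t.2.2.1 = ψ := toHom_factorOf hF hpair hA hB ψ
  have hn : t.1 = 1 := by
    have hd := degFr_factor hpair hF hA t.1 t.2.1 t.2.2.2
    rw [h] at hd
    exact hd.symm.trans hlin
  -- `β = u · s`, `Ψ(β) = u^ζ · s`, and the unit `w := u⁻¹ · u^ζ`
  set β := t.2.1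
  set u := splitU hF τ (histr A) β
  set s := splitT hF τ (histr A) β
  have hβ : unitsToEnd F A u * tauToEnd τ (histr A) s = β := split_spec hF τ (histr A) β
  let w : unitsSubgroup F A := u⁻¹ * zetaPow hF hup ζ A u
  have hw : β * unitsToEnd F A w = zetaUnitMap hF hup ζ τ (histr A) β := by
    rw [zetaUnitMap_of_split hF hup ζ τ (histr A) hβ, ← hβ, mul_assoc, endSubmonoid_comm F hF (tauToEnd τ _ s),
      ← mul_assoc, ← map_mul, mul_inv_cancel_left]
  refine ⟨Arrow.isoMk (f := Arrow.mk (psiHom hF τ histr hup hpair ζ hA hB ψ)) (g := Arrow.mk ψ) w.1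
    (Iso.refl B) ?_⟩
  show w.1.hom ≫ ψ = psiHom hF τ histr hup hpair ζ hA hB ψ ≫ 𝟙 B
  rw [Category.comp_id, ← h, psiHom_factor hF τ histr hup hpair ζ hA hB t.1 t.2.1 t.2.2.2, hn, frob_one,
    Category.id_comp, Category.id_comp, ← Category.assoc, ← hw]
  rfl

/-- `Ψ_P(ψ)` is abstractly equivalent to `ψ` for a base-isomorphic isometry `ψ` between `P`-objects
(e.g. a morphism of Frobenius type): `ψ = F(n) ; u ; α` with `u` a unit and `α` an isomorphism,
`Ψ_P(ψ) = F(n) ; u^ζ ; α = ψ ; α⁻¹ (u⁻¹ u^ζ) α`. [cite: MochizukiFrdI2008, Prop. 2.9(ii) p.55] -/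
theorem arrowIso_of_isIsometry {A B : C} (hA : P.obj A) (hB : P.obj B) (ψ : A ⟶ B) (hi : IsIsometry F ψ)
    (hb : IsBaseIso F ψ) : IsAbstractlyEquivalent (psiHom hF τ histr hup hpair ζ hA hB ψ) ψ := by
  have hP := hpair.isBaseSection
  set t := factorOf hF hpair hA hB ψ
  have h : frob Fr t.1 hA ≫ (t.2.1.1 : A ⟶ A) ≫ t.2.2.1 = ψ := toHom_factorOf hF hpair hA hB ψ
  set β := t.2.1
  set α := t.2.2.1
  -- `β` is a unit
  have hβu : IsUnit β := by
    rw [← associated_one_iff_isUnit, ← div_eq_div_iff_associated F hF, map_one,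
      ← div_factor hF hpair hA t.1 β t.2.2.2, h]
    exact hi
  set u := unitOf hβu
  have hu : unitsToEnd F A u = β := unitsToEnd_unitOf hβu
  -- `α` is an isomorphism
  have hαb : IsBaseIso F α := by
    have hb' : IsIso (Base F ψ) := hb
    rw [← h, base_factor hpair hA t.1 β α] at hb'
    exact hb'
  have hαiso : IsIso α := (isPullbackMorphism_and_isBaseIso_iff_isIso F α).mp ⟨hP.hom_pullback α t.2.2.2, hαb⟩
  -- the unit `w := u · (u^ζ)⁻¹` with `u^ζ ; w = u`
  let w : unitsSubgroup F A := u * (zetaPow hF hup ζ A u)⁻¹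
  have hw : (zetaPow hF hup ζ A u).1.hom ≫ w.1.hom = u.1.hom := by
    show (w * zetaPow hF hup ζ A u).1.hom = u.1.hom
    rw [inv_mul_cancel_right]
  refine ⟨Arrow.isoMk (f := Arrow.mk (psiHom hF τ histr hup hpair ζ hA hB ψ)) (g := Arrow.mk ψ) (Iso.refl A)
    ((@asIso _ _ _ _ α hαiso).symm ≪≫ w.1 ≪≫ @asIso _ _ _ _ α hαiso) ?_⟩
  show 𝟙 A ≫ ψ = psiHom hF τ histr hup hpair ζ hA hB ψ ≫ (@inv _ _ _ _ α hαiso ≫ w.1.hom ≫ α)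
  rw [Category.id_comp, ← h, psiHom_factor hF τ histr hup hpair ζ hA hB t.1 β t.2.2.2, ← hu,
    zetaUnitMap_unitsToEnd, unitsToEnd_val, unitsToEnd_val]
  simp only [Category.assoc]
  rw [@IsIso.hom_inv_id_assoc _ _ _ _ α hαiso, ← Category.assoc (zetaPow hF hup ζ A u).1.hom, hw]

include hnorm hbt in
/-- **Prop. 2.9 (ii)(b), arrows**: `Ψ` maps a morphism of Frobenius type, a pre-step or a pull-back
morphism to an abstractly equivalent arrow. [cite: MochizukiFrdI2008, Prop. 2.9(ii) p.53] -/
theorem psi_arrows {A B : C} (φ : A ⟶ B) (hφ : IsFrobeniusType F φ ∨ IsPreStep F φ ∨ IsPullbackMorphism F φ) :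
    IsAbstractlyEquivalent ((psi hF τ hnorm hbt histr hup hpair ζ).map φ) φ := by
  have hPF := hF.isPreFrobenioid
  let iA := repIso hbt hpair A
  let iB := repIso hbt hpair B
  let ψ : (repP hpair A).1 ⟶ (repP hpair B).1 := iA.inv ≫ φ ≫ iB.hom
  have h1 : IsAbstractlyEquivalent ((psi hF τ hnorm hbt histr hup hpair ζ).map φ) ψ := by
    rw [psi_map]
    rcases hφ with hft | hlin
    · refine arrowIso_of_isIsometry hF τ histr hup hpair ζ _ _ ψ ?_ ?_
      · exact (isIsometry_of_isIso F hPF iA.inv).comp F ((hft.1.2).comp F (isIsometry_of_isIso F hPF iB.hom))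
      · haveI : IsIso (Base F φ) := hft.2
        haveI : IsIso (Base F iA.inv) := isBaseIso_of_isIso F iA.inv
        haveI : IsIso (Base F iB.hom) := isBaseIso_of_isIso F iB.hom
        show IsIso (Base F (iA.inv ≫ φ ≫ iB.hom))
        rw [base_comp, base_comp]; infer_instance
    · refine arrowIso_of_isLinear hF τ histr hup hpair ζ _ _ ψ ?_
      have hl : IsLinear F φ := hlin.elim (fun h => h.1) (fun h => (hF.iv_b φ h).2)
      show degFr F (iA.inv ≫ φ ≫ iB.hom) = 1
      rw [degFr_comp, degFr_comp, isLinear_of_isIso F iA.inv, hl, isLinear_of_isIso F iB.hom, one_mul, one_mul]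
  refine h1.trans ⟨Arrow.isoMk (f := Arrow.mk ψ) (g := Arrow.mk φ) iA.symm iB.symm ?_⟩
  show iA.inv ≫ φ = (iA.inv ≫ φ ≫ iB.hom) ≫ iB.inv
  rw [Category.assoc, Category.assoc, iB.hom_inv_id, Category.comp_id]

/-! ### (c): units -/

/-- `Ψ_P` on a unit `w ∈ O^×(A)`, `A ∈ Ob(P)`: `Ψ_P(w) = w^ζ`. [cite: MochizukiFrdI2008, Prop. 2.9(ii) p.55] -/
theorem psiHom_unit {A : C} (hA : P.obj A) (w : unitsSubgroup F A) :
    psiHom hF τ histr hup hpair ζ hA hA w.1.hom = (zetaPow hF hup ζ A w).1.hom := by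
  have h : w.1.hom = frob Fr 1 hA ≫ ((unitsToEnd F A w).1 : A ⟶ A) ≫ 𝟙 A := by
    rw [frob_one, Category.id_comp, Category.comp_id]; rfl
  rw [h, psiHom_factor hF τ histr hup hpair ζ hA hA 1 _ (P.hom_id hA), zetaUnitMap_unitsToEnd, frob_one,
    Category.id_comp, Category.comp_id]
  rfl

include hnorm in
/-- **Prop. 2.9 (ii)(c)**: for each `A` an isomorphism `Ψ(A) ≅ A` such that `Ψ` on `O^×(A)` followed
by conjugation by this isomorphism is raising to the `ζ`-th power (for the chosen profinite topology
of `O^×(A)`). [cite: MochizukiFrdI2008, Prop. 2.9(ii) p.53] -/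
theorem psi_units (A : C) :
    ∃ (e : (psi hF τ hnorm hbt histr hup hpair ζ).obj A ≅ A) (t : TopologicalSpace (unitsSubgroup F A))
      (f : unitsSubgroup F A → unitsSubgroup F A),
      @IsTfgProfinite _ _ t ∧ @IsZetaPowerMap _ (unitsCommGroup F hF A) t ζ f ∧
        ∀ u : unitsSubgroup F A,
          e.inv ≫ (psi hF τ hnorm hbt histr hup hpair ζ).map u.1.hom ≫ e.hom = (f u).1.hom := by
  let i := repIso hbt hpair A
  refine ⟨i.symm, unitsTopology hup A, zetaPow hF hup ζ A, isTfgProfinite_unitsTopology hup A,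
    isZetaPowerMap_zetaPow hF hup ζ A, fun u => ?_⟩
  rw [psi_map]
  show i.hom ≫ psiHom hF τ histr hup hpair ζ _ _ (i.inv ≫ u.1.hom ≫ i.hom) ≫ i.inv = _
  rw [← conjUnits_hom, psiHom_unit hF τ histr hup hpair ζ (repP_mem hpair A)]
  have h := conjUnits_hom (F := F) i.symm (zetaPow hF hup ζ _ (conjUnits (F := F) i u))
  rw [Iso.symm_inv, Iso.symm_hom] at h
  rw [← h, map_zetaPow hF hup ζ (conjUnits (F := F) i.symm), conjUnits_symm_conjUnits]

/-! ### (d) -/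

/-- `Ψ_P` is injective on arrows when `Ψ_A` is (e.g. `ζ` of co-prime type).
[cite: MochizukiFrdI2008, Prop. 2.9(ii) p.55] -/
theorem psiHom_injective (hζ : IsOfCoprimeType ζ) {A B : C} (hA : P.obj A) (hB : P.obj B) {ψ₁ ψ₂ : A ⟶ B}
    (h : psiHom hF τ histr hup hpair ζ hA hB ψ₁ = psiHom hF τ histr hup hpair ζ hA hB ψ₂) : ψ₁ = ψ₂ := by
  set t₁ := factorOf hF hpair hA hB ψ₁
  set t₂ := factorOf hF hpair hA hB ψ₂
  have e₁ := factorOf_eq hF hpair hA hB (φ := psiHom hF τ histr hup hpair ζ hA hB ψ₁)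
    (t := (t₁.1, zetaUnitMap hF hup ζ τ (histr A) t₁.2.1, t₁.2.2)) rfl
  have e₂ := factorOf_eq hF hpair hA hB (φ := psiHom hF τ histr hup hpair ζ hA hB ψ₁)
    (t := (t₂.1, zetaUnitMap hF hup ζ τ (histr A) t₂.2.1, t₂.2.2)) (by rw [h]; rfl)
  have e := e₁.symm.trans e₂
  obtain ⟨hn, e'⟩ := Prod.mk.inj e
  obtain ⟨hβ', hα⟩ := Prod.mk.inj e'
  have hβ : t₁.2.1 = t₂.2.1 := (zetaUnitMap_bijective hF hup ζ τ hζ (histr A)).1 hβ'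
  rw [← toHom_factorOf hF hpair hA hB ψ₁, ← toHom_factorOf hF hpair hA hB ψ₂]
  show frob Fr t₁.1 hA ≫ (t₁.2.1.1 : A ⟶ A) ≫ t₁.2.2.1 = frob Fr t₂.1 hA ≫ (t₂.2.1.1 : A ⟶ A) ≫ t₂.2.2.1
  rw [hn, hβ, hα]

/-- `Ψ_P` is surjective on arrows when `Ψ_A` is. [cite: MochizukiFrdI2008, Prop. 2.9(ii) p.55] -/
theorem psiHom_surjective (hζ : IsOfCoprimeType ζ) {A B : C} (hA : P.obj A) (hB : P.obj B) (g : A ⟶ B) :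
    ∃ ψ : A ⟶ B, psiHom hF τ histr hup hpair ζ hA hB ψ = g := by
  set t := factorOf hF hpair hA hB g
  obtain ⟨β, hβ⟩ := (zetaUnitMap_bijective hF hup ζ τ hζ (histr A)).2 t.2.1
  refine ⟨frob Fr t.1 hA ≫ (β.1 : A ⟶ A) ≫ t.2.2.1, ?_⟩
  rw [psiHom_factor hF τ histr hup hpair ζ hA hB t.1 β t.2.2.2, hβ]
  exact toHom_factorOf hF hpair hA hB g

include hnorm hbt in
/-- **Prop. 2.9 (ii)(d)**, first part: for `ζ` of co-prime type `Ψ` is an equivalence of categories.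
[cite: MochizukiFrdI2008, Prop. 2.9(ii) p.53] -/
theorem psi_isEquivalence (hζ : IsOfCoprimeType ζ) : (psi hF τ hnorm hbt histr hup hpair ζ).IsEquivalence := by
  let Ψ := psi hF τ hnorm hbt histr hup hpair ζ
  haveI : Ψ.Faithful := ⟨fun {A B} φ₁ φ₂ h => by
    have h' : (repIso hbt hpair A).inv ≫ φ₁ ≫ (repIso hbt hpair B).hom =
        (repIso hbt hpair A).inv ≫ φ₂ ≫ (repIso hbt hpair B).hom :=
      psiHom_injective hF τ histr hup hpair ζ hζ (repP_mem hpair A) (repP_mem hpair B) h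
    exact (cancel_mono (repIso hbt hpair B).hom).mp ((cancel_epi (repIso hbt hpair A).inv).mp h')⟩
  haveI : Ψ.Full := ⟨fun {A B} g => by
    obtain ⟨ψ, hψ⟩ := psiHom_surjective hF τ histr hup hpair ζ hζ (repP_mem hpair A) (repP_mem hpair B) g
    refine ⟨(repIso hbt hpair A).hom ≫ ψ ≫ (repIso hbt hpair B).inv, ?_⟩
    have harg : (repIso hbt hpair A).inv ≫ ((repIso hbt hpair A).hom ≫ ψ ≫ (repIso hbt hpair B).inv) ≫
        (repIso hbt hpair B).hom = ψ := by
      simp only [Category.assoc, Iso.inv_hom_id, Category.comp_id, Iso.inv_hom_id_assoc]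
    rw [psi_map, harg]
    exact hψ⟩
  haveI : Ψ.EssSurj := ⟨fun Y => ⟨Y, ⟨(repIso hbt hpair Y).symm⟩⟩⟩
  exact {}

include hnorm in
/-- **Prop. 2.9 (ii)(d)**, second part: if `C` is of unit-trivial type then `Ψ ≅ 𝟭`.
[cite: MochizukiFrdI2008, Prop. 2.9(ii) p.53] -/
theorem psi_iso_id (hut : IsOfType (IsUnitTrivial F)) : Nonempty (psi hF τ hnorm hbt histr hup hpair ζ ≅ 𝟭 C) := by
  have hid : ∀ {A B : C} (hA : P.obj A) (hB : P.obj B) (ψ : A ⟶ B), psiHom hF τ histr hup hpair ζ hA hB ψ = ψ := by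
    intro A B hA hB ψ
    set t := factorOf hF hpair hA hB ψ
    have h := toHom_factorOf hF hpair hA hB ψ
    conv_lhs => rw [← h]
    show psiHom hF τ histr hup hpair ζ hA hB (frob Fr t.1 hA ≫ (t.2.1.1 : A ⟶ A) ≫ t.2.2.1) = ψ
    rw [psiHom_factor hF τ histr hup hpair ζ hA hB t.1 t.2.1 t.2.2.2,
      zetaUnitMap_of_isUnitTrivial hF hup ζ τ (histr A) (hut A)]
    exact h
  refine ⟨NatIso.ofComponents (fun A => (repIso hbt hpair A).symm) ?_⟩
  intro A B φ
  show (psi hF τ hnorm hbt histr hup hpair ζ).map φ ≫ (repIso hbt hpair B).inv = (repIso hbt hpair A).inv ≫ φ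
  rw [psi_map, hid]
  erw [Category.assoc, Category.assoc, Iso.hom_inv_id, Category.comp_id]
  try rfl

end UnitWiseFrobeniusZeta

/-- **Prop. 2.9 (ii)** (unit-wise Frobenius functors II): the named statement
`UnitWiseFrobeniusZetaExists F ζ` of `BaseFrobeniusSections.lean` — for every characteristic splitting
`τ` and `ζ : Primes → ℕ_{≥1}`, a Frobenioid of Frobenius-normalized, base-trivial, isotropic,
`Aut`-ample, pre-model and unit-profinite type admits a unit-wise Frobenius functor with (a)–(d).
(`Aut`-ampleness is idle, cf. Remark 2.9.2; the paper's reduction to a skeleton is replaced by a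
retraction onto the base-section.) [cite: MochizukiFrdI2008, Prop. 2.9(ii) p.53] -/
theorem unitWiseFrobeniusZetaExists {D : Type u} [Category.{v} D] {Φ : Dᵒᵖ ⥤ CommMonCat.{w}} {C : Type u'}
    [Category.{v'} C] {F : C ⥤ ElemFrobenioid Φ} (ζ : Nat.Primes → ℕ+) : UnitWiseFrobeniusZetaExists F ζ := by
  intro τ hF hnorm hbt histr _ hpm hup
  obtain ⟨P, Fr, hpair⟩ := hpm
  exact ⟨UnitWiseFrobeniusZeta.psi hF τ hnorm hbt histr hup hpair ζ,
    UnitWiseFrobeniusZeta.psi_oneCommutes hF τ hnorm hbt histr hup hpair ζ,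
    fun A => ⟨(UnitWiseFrobeniusZeta.repIso hbt hpair A).symm⟩,
    fun φ hφ => UnitWiseFrobeniusZeta.psi_arrows hF τ hnorm hbt histr hup hpair ζ φ hφ,
    fun A => UnitWiseFrobeniusZeta.psi_units hF τ hnorm hbt histr hup hpair ζ A,
    fun hζ => UnitWiseFrobeniusZeta.psi_isEquivalence hF τ hnorm hbt histr hup hpair ζ hζ,
    fun hut => UnitWiseFrobeniusZeta.psi_iso_id hF τ hnorm hbt histr hup hpair ζ hut⟩

end PreFrobenioid

end Literature.AlgebraicGeometry.Frobenioids
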